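import Literature.AlgebraicGeometry.Motives.AbelianVarietyPurelyTranscendentalPoints
import Literature.AlgebraicGeometry.Motives.AbelianVarietyProofs
import Literature.AlgebraicGeometry.Limits.SubalgebraDiagram
import Mathlib.RingTheory.AlgebraicIndependent.Adjoin
import HarnessLib

/-!
# `A(k(x_i)_{i ∈ S}) = A(k)` for an ARBITRARY set of variables (Milne, *Abelian Varieties*, §3
# Cor. 3.8, with the finite presentation of `A`)

Sequel to `Motives/AbelianVarietyPurelyTranscendentalPoints` (the case of finitely many
variables).  For an abelian variety `A` over an infinite field `k` and a field `K` which is a field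
of fractions of the polynomial ring `k[x_S]` in ANY set of variables `S` (over `k`), **every
`K`-valued point of `A` over `k` is the constant point at a `k`-rational point of `A`**
(`AbelianVariety.algPoints_const_of_isFractionRing_mvPolynomial_index`).

Proof.  `A → Spec k` is locally of finite presentation (it is smooth, the tree's
`AbelianVariety.smooth_hom`) and `Spec K = lim_t Spec k[t]` over the finite subsets `t ⊆ K` (the
tree's subalgebra diagram `Limits/SubalgebraDiagram`, `SubalgApprox.isLimitForgetBaseCone`), so a
`K`-point `x : Spec K → A` factors through `Spec k[t] → A` for a finite `t ⊆ K` (Mathlib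
`Scheme.exists_π_app_comp_eq_of_locallyOfFinitePresentation`, Stacks 01ZC) —
`AbelianVariety.exists_factor_adjoin_finset`.  The finitely many elements of `t` are rational
functions in finitely many of the variables, i.e. `k[t] ⊆ k(y₁, …, yₙ) ⊆ K` for finitely many of the
`x_i` (Mathlib `IntermediateField.exists_finset_of_mem_adjoin`), and `k(y₁, …, yₙ) ≅ Frac k[y₁, …, yₙ]`
(Mathlib `AlgebraicIndependent.aevalEquivField`); so `x` comes from a `k(y₁, …, yₙ)`-point, which is
constant by the finite case (`AbelianVariety.algPoints_const_of_algEquiv_mvPolynomial`).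

Everything is proved; no definitions, no named facts.  Junction K-∞ of the abc-iut cell's plan for
[AbsTopIII] Rmk. 1.5.4 (iii) (abelian-variety clause of the Kummer-faithfulness of
`ℚ_p(x_i)_{i ∈ I}`, `I` infinite).  HONEST FRAMING: classical; nothing here bears on [IUTchIII].

## References

* J. S. Milne, *Abelian Varieties*, in Cornell–Silverman (eds.), *Arithmetic Geometry* (1986),
  Ch. V, §3 Cor. 3.8. [Milne1986AbelianVarieties]
* The Stacks Project, Tag 01ZC (morphisms into a scheme locally of finite presentation factor
  through a stage of a limit). [StacksProject]
* U. Görtz, T. Wedhorn, *Algebraic Geometry I* (2nd ed. 2020), (10.13), Thm. 10.57. [GortzWedhorn2020]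
-/

noncomputable section

universe u v

open CategoryTheory CategoryTheory.Limits AlgebraicGeometry MvPolynomial

namespace Literature.AlgebraicGeometry.Motives

open Literature.AlgebraicGeometry.Limits

variable {k : Type u} [Field k]

/-! ## Finite presentation: a field-valued point factors through a finitely generated subalgebra -/

/-- **A field-valued point of an abelian variety factors through `Spec` of a finitely generated
subalgebra** (Stacks 01ZC for `Spec K = lim_t Spec k[t]`): for `x : Spec K → A` over `k` there are a
finite `t ⊆ K` and a `k`-morphism `g : Spec k[t] → A` with `Spec (k[t] ⊆ K) ≫ g = x`.
[cite: StacksProject, Tag 01ZC] [cite: GortzWedhorn2020, Thm. 10.57] -/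
theorem AbelianVariety.exists_factor_adjoin_finset (A : AbelianVariety k) {K : Type u} [Field K]
    [Algebra k K] (x : AlgPoints A.X K) :
    ∃ (t : Finset K) (g : Spec (.of (Algebra.adjoin k (t : Set K))) ⟶ A.X.left),
      g ≫ A.X.hom = Spec.map (CommRingCat.ofHom (algebraMap k (Algebra.adjoin k (t : Set K)))) ∧
        Spec.map (CommRingCat.ofHom (Algebra.adjoin k (t : Set K)).val.toRingHom) ≫ g = x.left := by
  classical
  haveI : Smooth A.X.hom := A.smooth_hom
  -- the diagram `t ↦ Spec k[t]` of schemes and its cone `Spec K`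
  let D : (SubalgApprox.Idx K (∅ : Finset K))ᵒᵖ ⥤ Scheme.{u} :=
    SubalgApprox.baseDiagram k K ∅ ⋙ Over.forget _
  let τ : D ⟶ (Functor.const _).obj (Spec (.of k)) :=
    { app := fun j => ((SubalgApprox.baseDiagram k K ∅).obj j).hom
      naturality := fun j j' φ => by
        change ((SubalgApprox.baseDiagram k K ∅).map φ).left ≫
            ((SubalgApprox.baseDiagram k K ∅).obj j').hom =
          ((SubalgApprox.baseDiagram k K ∅).obj j).hom ≫ 𝟙 _
        rw [Over.w, Category.comp_id] }
  haveI : ∀ {j j' : (SubalgApprox.Idx K (∅ : Finset K))ᵒᵖ} (φ : j ⟶ j'), IsAffineHom (D.map φ) :=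
    fun φ => SubalgApprox.isAffineHom_baseDiagram_map_left k K ∅ φ
  haveI : ∀ j, CompactSpace (D.obj j) := fun j =>
    inferInstanceAs (CompactSpace ((SubalgApprox.baseDiagram k K ∅).obj j).left)
  haveI : ∀ j, QuasiSeparatedSpace (D.obj j) := fun j =>
    inferInstanceAs (QuasiSeparatedSpace ((SubalgApprox.baseDiagram k K ∅).obj j).left)
  have ha : ((Over.forget _).mapCone (SubalgApprox.baseCone k K ∅)).π ≫ τ =
      (Functor.const _).map (x.left ≫ A.X.hom) := by
    ext j
    change ((SubalgApprox.baseCone k K ∅).π.app j).left ≫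
        ((SubalgApprox.baseDiagram k K ∅).obj j).hom = x.left ≫ A.X.hom
    rw [Over.w, Over.w]
    rfl
  obtain ⟨j, g, hg, hg'⟩ := Scheme.exists_π_app_comp_eq_of_locallyOfFinitePresentation D τ
    A.X.hom ((Over.forget _).mapCone (SubalgApprox.baseCone k K ∅))
    (SubalgApprox.isLimitForgetBaseCone k K ∅) x.left ha
  exact ⟨j.unop.1, g, hg', hg⟩

/-! ## Arbitrary sets of variables -/

/-- For a field of fractions `K` of `k[x_S]` over `k`, the images of the variables are algebraically
independent over `k`. [cite: Milne1986AbelianVarieties, §3 Cor. 3.8] -/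
theorem algebraicIndependent_algebraMap_X {S : Type u} (K : Type u) [Field K] [Algebra k K]
    [Algebra (MvPolynomial S k) K] [IsScalarTower k (MvPolynomial S k) K]
    [IsFractionRing (MvPolynomial S k) K] :
    AlgebraicIndependent k fun i : S => algebraMap (MvPolynomial S k) K (MvPolynomial.X i) := by
  rw [algebraicIndependent_iff_injective_aeval]
  have h : MvPolynomial.aeval (fun i : S => algebraMap (MvPolynomial S k) K (MvPolynomial.X i)) =
      IsScalarTower.toAlgHom k (MvPolynomial S k) K :=
    MvPolynomial.algHom_ext fun i => by simp
  rw [h]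
  exact IsFractionRing.injective (MvPolynomial S k) K

/-- For a field of fractions `K` of `k[x_S]` over `k`, every element of `K` is a rational function in
the variables: `K = k(x_S)` as an intermediate field. [cite: Milne1986AbelianVarieties, §3 Cor. 3.8] -/
theorem mem_adjoin_range_algebraMap_X {S : Type u} (K : Type u) [Field K] [Algebra k K]
    [Algebra (MvPolynomial S k) K] [IsScalarTower k (MvPolynomial S k) K]
    [IsFractionRing (MvPolynomial S k) K] (b : K) :
    b ∈ IntermediateField.adjoin k
      (Set.range fun i : S => algebraMap (MvPolynomial S k) K (MvPolynomial.X i)) := by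
  set z : S → K := fun i => algebraMap (MvPolynomial S k) K (MvPolynomial.X i) with hz
  have haeval : MvPolynomial.aeval z = IsScalarTower.toAlgHom k (MvPolynomial S k) K :=
    MvPolynomial.algHom_ext fun i => by simp [z]
  have hmem : ∀ a : MvPolynomial S k, algebraMap (MvPolynomial S k) K a ∈
      IntermediateField.adjoin k (Set.range z) := fun a => by
    have h1 : algebraMap (MvPolynomial S k) K a ∈ Algebra.adjoin k (Set.range z) := by
      rw [Algebra.adjoin_range_eq_range_aeval, haeval]
      exact ⟨a, rfl⟩
    exact IntermediateField.algebra_adjoin_le_adjoin k _ h1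
  obtain ⟨a, c, -, rfl⟩ := IsFractionRing.div_surjective (A := MvPolynomial S k) b
  exact div_mem (hmem a) (hmem c)

/-- **Transfer of a point along a finitely generated subalgebra contained in an intermediate
field**: if `x : Spec K → A` factors through `Spec k[t]` and `k[t] ⊆ L ⊆ K` for an intermediate field
`L`, then `x` comes from an `L`-valued point of `A` (bookkeeping). [cite: StacksProject, Tag 01ZC] -/
theorem AbelianVariety.exists_algPoints_of_adjoin_le (A : AbelianVariety k) {K : Type u} [Field K]
    [Algebra k K] (x : AlgPoints A.X K) (t : Finset K)
    (g : Spec (.of (Algebra.adjoin k (t : Set K))) ⟶ A.X.left)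
    (hgw : g ≫ A.X.hom = Spec.map (CommRingCat.ofHom (algebraMap k (Algebra.adjoin k (t : Set K)))))
    (hg : Spec.map (CommRingCat.ofHom (Algebra.adjoin k (t : Set K)).val.toRingHom) ≫ g = x.left)
    (L : IntermediateField k K) (ht : ∀ b ∈ Algebra.adjoin k (t : Set K), b ∈ L) :
    ∃ xL : AlgPoints A.X L, x = AlgPoints.specOverMapOfAlgHom (L.val : L →ₐ[k] K) ≫ xL := by
  -- the inclusion `k[t] ⊆ L`
  let incl : Algebra.adjoin k (t : Set K) →+* L :=
    (Algebra.adjoin k (t : Set K)).val.toRingHom.codRestrict L fun a => ht a a.2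
  have hincl_alg : incl.comp (algebraMap k (Algebra.adjoin k (t : Set K))) = algebraMap k L := by
    refine RingHom.ext fun c => Subtype.ext ?_
    change ((algebraMap k (Algebra.adjoin k (t : Set K)) c : Algebra.adjoin k (t : Set K)) : K) =
      ((algebraMap k L c : L) : K)
    rw [Subalgebra.coe_algebraMap, IntermediateField.coe_algebraMap_apply]
  have hval_incl : (L.val : L →ₐ[k] K).toRingHom.comp incl =
      (Algebra.adjoin k (t : Set K)).val.toRingHom :=
    RingHom.ext fun a => rfl
  have hxL_w : (Spec.map (CommRingCat.ofHom incl) ≫ g) ≫ A.X.hom = (specOver k L).hom := by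
    rw [Category.assoc, hgw, specMap_ofHom_comp_specMap_ofHom, hincl_alg]
    rfl
  refine ⟨Over.homMk (Spec.map (CommRingCat.ofHom incl) ≫ g) hxL_w, ?_⟩
  apply Over.OverMorphism.ext
  change x.left = Spec.map (CommRingCat.ofHom (L.val : L →ₐ[k] K).toRingHom) ≫
    (Spec.map (CommRingCat.ofHom incl) ≫ g)
  rw [← Category.assoc, specMap_ofHom_comp_specMap_ofHom, hval_incl, hg]

/-- **Finitely many elements of `k(x_S)` involve finitely many variables**: for a finite `t ⊆ K`,
`K` a field of fractions of `k[x_S]` over `k`, there are finitely many of the variables, reindexed as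
an algebraically independent family `y : Fin n → K`, with `k[t] ⊆ k(y₁, …, yₙ)`.
[cite: Milne1986AbelianVarieties, §3 Cor. 3.8] -/
theorem exists_fin_algebraicIndependent_adjoin_le {S : Type u} (K : Type u) [Field K] [Algebra k K]
    [Algebra (MvPolynomial S k) K] [IsScalarTower k (MvPolynomial S k) K]
    [IsFractionRing (MvPolynomial S k) K] (t : Finset K) :
    ∃ (n : ℕ) (y : Fin n → K), AlgebraicIndependent k y ∧
      ∀ b ∈ Algebra.adjoin k (t : Set K), b ∈ IntermediateField.adjoin k (Set.range y) := by
  classical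
  let z : S → K := fun i => algebraMap (MvPolynomial S k) K (MvPolynomial.X i)
  have hzind : AlgebraicIndependent k z := algebraicIndependent_algebraMap_X K
  have hT : ∀ b : K, ∃ Tb : Finset K, (Tb : Set K) ⊆ Set.range z ∧
      b ∈ IntermediateField.adjoin k (Tb : Set K) := fun b =>
    IntermediateField.exists_finset_of_mem_adjoin (mem_adjoin_range_algebraMap_X K b)
  choose Tb hTbsub hTbmem using hT
  let T' : Finset K := t.biUnion Tb
  have hT'sub : (T' : Set K) ⊆ Set.range z := by
    intro e he
    rw [Finset.mem_coe, Finset.mem_biUnion] at he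
    obtain ⟨b, -, hb⟩ := he
    exact hTbsub b hb
  have hind := hzind.to_subtype_range.mono hT'sub
  -- reindex by `Fin n`
  let eFin := T'.equivFin
  let f : Fin T'.card → (T' : Set K) := fun i => ⟨(eFin.symm i).1, (eFin.symm i).2⟩
  have hf : Function.Injective f := fun i j h => by
    apply eFin.symm.injective
    exact Subtype.ext (congrArg Subtype.val h)
  have hy : AlgebraicIndependent k (Subtype.val ∘ f) := hind.comp f hf
  have hrange : Set.range (Subtype.val ∘ f) = (T' : Set K) := by
    ext e
    constructor
    · rintro ⟨i, rfl⟩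
      exact (eFin.symm i).2
    · intro he
      refine ⟨eFin ⟨e, he⟩, ?_⟩
      change ((eFin.symm (eFin ⟨e, he⟩)).1 : K) = e
      rw [Equiv.symm_apply_apply]
  refine ⟨T'.card, Subtype.val ∘ f, hy, fun b hb => ?_⟩
  have hle : Algebra.adjoin k (t : Set K) ≤
      (IntermediateField.adjoin k (Set.range (Subtype.val ∘ f))).toSubalgebra := by
    refine Algebra.adjoin_le fun b' hb' => ?_
    have h2 : IntermediateField.adjoin k (Tb b' : Set K) ≤
        IntermediateField.adjoin k (Set.range (Subtype.val ∘ f)) := by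
      rw [hrange]
      exact IntermediateField.adjoin.mono k _ _
        (Finset.coe_subset.2 (Finset.subset_biUnion_of_mem Tb (Finset.mem_coe.1 hb')))
    exact h2 (hTbmem b')
  exact hle hb

/-- **`A(K) = A(k)` for a rational function field `K = k(x_i)_{i ∈ S}` in ANY set of variables**
(`k` infinite): every `K`-valued point of an abelian variety `A / k` over a field of fractions `K` of
`k[x_S]` is the constant point at a `k`-point of `A`.  The point factors through a finitely generated
subalgebra `k[t] ⊆ K` (`exists_factor_adjoin_finset`), `k[t] ⊆ k(y₁, …, yₙ)` for finitely many of the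
variables, and `A(k(y₁, …, yₙ)) = A(k)` (`algPoints_const_of_algEquiv_mvPolynomial`).
[cite: Milne1986AbelianVarieties, §3 Cor. 3.8] -/
theorem AbelianVariety.algPoints_const_of_isFractionRing_mvPolynomial_index [Infinite k]
    (A : AbelianVariety k) (S : Type u) (K : Type u) [Field K] [Algebra k K]
    [Algebra (MvPolynomial S k) K] [IsScalarTower k (MvPolynomial S k) K]
    [IsFractionRing (MvPolynomial S k) K] (x : AlgPoints A.X K) :
    ∃ P₀ : AlgPoints A.X k, x = AlgPoints.specOverMapOfAlgHom (Algebra.ofId k K) ≫ P₀ := by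
  -- Step 1: `x` factors through `Spec k[t]`, `t ⊆ K` finite
  obtain ⟨t, g, hgw, hg⟩ := A.exists_factor_adjoin_finset x
  -- Step 2: `k[t] ⊆ k(y)`, `y : Fin n → K` algebraically independent
  obtain ⟨n, y, hy, ht⟩ := exists_fin_algebraicIndependent_adjoin_le (k := k) (S := S) K t
  obtain ⟨xL, hxL⟩ := A.exists_algPoints_of_adjoin_le x t g hgw hg
    (IntermediateField.adjoin k (Set.range y)) ht
  -- Step 3: the finite case over `k(y) ≅ Frac k[y₁, …, yₙ]`
  obtain ⟨P₀, hP₀⟩ := A.algPoints_const_of_algEquiv_mvPolynomial n hy.aevalEquivField xL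
  refine ⟨P₀, ?_⟩
  have hψ : ((IntermediateField.adjoin k (Set.range y)).val :
        IntermediateField.adjoin k (Set.range y) →ₐ[k] K).comp
      (Algebra.ofId k (IntermediateField.adjoin k (Set.range y))) = Algebra.ofId k K :=
    Subsingleton.elim _ _
  rw [hxL, hP₀, ← Category.assoc, specOverMapOfAlgHom_comp_specOverMapOfAlgHom, hψ]

/-- **`A(K) = A(k)` along an identification `K ≅ Frac k[x_S]` over `k`** (`S` any set of variables,
`k` infinite). [cite: Milne1986AbelianVarieties, §3 Cor. 3.8] -/
theorem AbelianVariety.algPoints_const_of_algEquiv_mvPolynomial_index [Infinite k]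
    (A : AbelianVariety k) (S : Type u) {K : Type u} [Field K] [Algebra k K]
    (e : FractionRing (MvPolynomial S k) ≃ₐ[k] K) (x : AlgPoints A.X K) :
    ∃ P₀ : AlgPoints A.X k, x = AlgPoints.specOverMapOfAlgHom (Algebra.ofId k K) ≫ P₀ := by
  set x' : AlgPoints A.X (FractionRing (MvPolynomial S k)) :=
    AlgPoints.specOverMapOfAlgHom (e.symm : K →ₐ[k] FractionRing (MvPolynomial S k)) ≫ x with hx'
  obtain ⟨P₀, hP₀⟩ :=
    A.algPoints_const_of_isFractionRing_mvPolynomial_index S (FractionRing (MvPolynomial S k)) x'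
  refine ⟨P₀, ?_⟩
  have h1 : x = AlgPoints.specOverMapOfAlgHom (e : FractionRing (MvPolynomial S k) →ₐ[k] K) ≫ x' := by
    rw [hx', ← Category.assoc, specOverMapOfAlgHom_comp_specOverMapOfAlgHom]
    have : (e : FractionRing (MvPolynomial S k) →ₐ[k] K).comp
        (e.symm : K →ₐ[k] FractionRing (MvPolynomial S k)) = AlgHom.id k K := by
      ext b; exact e.apply_symm_apply b
    rw [this, specOverMapOfAlgHom_id', Category.id_comp]
  have hψ : (e : FractionRing (MvPolynomial S k) →ₐ[k] K).comp
      (Algebra.ofId k (FractionRing (MvPolynomial S k))) = Algebra.ofId k K :=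
    Subsingleton.elim _ _
  rw [h1, hP₀, ← Category.assoc, specOverMapOfAlgHom_comp_specOverMapOfAlgHom, hψ]

end Literature.AlgebraicGeometry.Motives
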